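import Literature.NumberTheory.Automorphic.UnitaryEigenvectorAnisotropic          -- ★ (F-guard): `hermForm_self_ne_zero_of_eigen_simple`, `hermForm_eigen_sub_eq_zero`
import Literature.LinearAlgebra.Matrix.BlockCentralizerDisjointSpectra              -- ★ `conj_eq_fromBlocks_of_commute`
import HarnessLib

/-!
# The `u`-EIGENVECTOR of a block-scalar unitary `ε = P (a·1 ⊕ u) P⁻¹`, `a ≠ u`, `u σ(u) = 1`: it is ANISOTROPIC, every element of `Z_U(ε)` has it as an eigenvector
# (eigenvalue of norm one, the remaining characteristic polynomial split off), and its stabiliser in `U(σ, J)` lies in `Z_U(ε)`  (N6nsGerm (S1)∕(S2), «compact mod M» CM-dress inputs)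

Topic `NumberTheory/Automorphic`; namespace `Literature.NumberTheory.Automorphic.UnitaryGroup`. KERNEL ONLY: theorems, no definition, no named fact, no instance,
no notation, no `sorry`.  Cell `pub/hodgecm-mathlib` (LEAD F0P3a-plan (g9) T8-38 (1); road «N6nsGerm» binder (B4-top)(3), p08 (g13) «=» 05:43:27Z on the CM-dress shape).

SETTING.  `K` a field with involution `σ`, `J` hermitian (`(J.map σ)ᵀ = J`) with `det J ≠ 0`, `U = U(σ, J)`; `ε ∈ U` with an adapted frame
`ε P = P · reindex e (a·1_m ⊕ u·1_{Fin 1})`, `a ≠ u`, `u σ(u) = 1` (the singular semisimple points `ι(a·1₂, u)` of (S1) and `ι(A_{a,b}, a) ∼ a·1₂ ⊕ b` of (S2)).  Put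
`v₁ := P e_{e(inr 0)}` (the last frame vector).

* §1 `mulVec_frameVec_eq_smul` (`ε v₁ = u v₁`), `frameVec_ne_zero`, `charpoly_eq_of_frame` (`χ_ε = (X − a)^{|m|}·(X − u)` up to order), **`hermForm_frameVec_ne_zero`**
  (`v₁` anisotropic, ★ (F-guard)).
* §2 `exists_blocks_of_commute`, **`exists_eigen_of_commute`** — `t ∈ U` commuting with `ε` ⇒ `t v₁ = λ v₁`, `λ σ(λ) = 1`, `χ_t = (X − λ)·q`.
* §3 `hermForm_frameVec_inl_eq_zero`, `eq_smul_one_add_smul_vecMulVec_of_frame` (`ε = a·1 + ((u−a)∕β)·v₁ ⊗ hermRow v₁`), **`commute_of_mulVec_frameVec_eq`** —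
  `g ∈ U`, `g v₁ = v₁` ⇒ `g` commutes with `ε` (so `Stab_U(v₁) ≤ Z_U(ε)`).

HONEST SCOPE.  Hermitian linear algebra over a field with involution.  HC_CM is proved only modulo the printed citations until rung 0 closes; this file discharges no printed
statement.

## References
* [Rogawski1990] J. D. Rogawski, *Automorphic Representations of Unitary Groups in Three Variables*, Ann. of Math. Stud. 123 (1990), §3.8 Prop. 3.8.1 p. 30 (frames at singular
  semisimple classes), §8.2 Prop. 8.2.1 p. 112.
* [Dieudonne1971GroupesClassiques] J. Dieudonné, *La géométrie des groupes classiques*, 3e éd. (1971), Chap. II §4.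
-/

set_option autoImplicit false

open Polynomial Matrix

namespace Literature.NumberTheory.Automorphic.UnitaryGroup

open Literature.LinearAlgebra.Matrix

variable {K : Type*} [Field K] (σ : K →+* K) {n m : Type*} [Fintype n] [DecidableEq n] [Fintype m] [DecidableEq m] (J : Matrix n n K)

/-! ## §1 The frame vector `v₁ = P e_{inr 0}`: eigenvector for `u`, non-zero, anisotropic -/

omit [Field K] [Fintype n] [DecidableEq n] [Fintype m] [DecidableEq m] in
/-- `(reindex e e (A ⊕ D)) (e j) (e i) = (A ⊕ D) j i`. [folklore] -/
private theorem reindex_apply_apply' (e : m ⊕ Fin 1 ≃ n) (M : Matrix (m ⊕ Fin 1) (m ⊕ Fin 1) K) (i j : m ⊕ Fin 1) :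
    Matrix.reindex e e M (e i) (e j) = M i j := by
  rw [Matrix.reindex_apply, Matrix.submatrix_apply, Equiv.symm_apply_apply, Equiv.symm_apply_apply]

omit [Fintype m] in
/-- The block-scalar matrix sends every frame coordinate vector to the corresponding scalar times itself. [cite: Rogawski1990, §3.8 Prop. 3.8.1 p. 30] -/
theorem reindex_fromBlocks_mulVec_single (e : m ⊕ Fin 1 ≃ n) (a u : K) (j : m ⊕ Fin 1) :
    Matrix.reindex e e (Matrix.fromBlocks (a • (1 : Matrix m m K)) 0 0 (u • (1 : Matrix (Fin 1) (Fin 1) K))) *ᵥ Pi.single (e j) 1 =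
      (Sum.elim (fun _ => a) (fun _ => u) j) • Pi.single (e j) 1 := by
  ext i
  rw [Matrix.mulVec_single_one, Matrix.col_apply, Pi.smul_apply, smul_eq_mul]
  obtain ⟨i, rfl⟩ := e.surjective i
  rw [reindex_apply_apply']
  by_cases hij : i = j
  · subst hij
    rw [Pi.single_eq_same, mul_one]
    rcases i with i | i
    · rw [Matrix.fromBlocks_apply₁₁, Matrix.smul_apply, Matrix.one_apply_eq, smul_eq_mul, mul_one, Sum.elim_inl]
    · rw [Matrix.fromBlocks_apply₂₂, Matrix.smul_apply, Matrix.one_apply_eq, smul_eq_mul, mul_one, Sum.elim_inr]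
  · rw [Pi.single_eq_of_ne (fun h => hij (e.injective h)), mul_zero]
    rcases i with i | i <;> rcases j with j | j
    · rw [Matrix.fromBlocks_apply₁₁, Matrix.smul_apply, Matrix.one_apply_ne (fun h => hij (congrArg Sum.inl h)), smul_zero]
    · rw [Matrix.fromBlocks_apply₁₂, Matrix.zero_apply]
    · rw [Matrix.fromBlocks_apply₂₁, Matrix.zero_apply]
    · rw [Matrix.fromBlocks_apply₂₂, Matrix.smul_apply, Matrix.one_apply_ne (fun h => hij (congrArg Sum.inr h)), smul_zero]

section Frame

variable {ε : GL n K} {P : GL n K} {e : m ⊕ Fin 1 ≃ n} {a u : K}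

omit [Fintype m] in
/-- **`ε v₁ = u v₁`** for `v₁ = P e_{inr 0}` under the frame `ε P = P (a·1 ⊕ u)`. [cite: Rogawski1990, §3.8 Prop. 3.8.1 p. 30] -/
theorem mulVec_frameVec_eq_smul
    (hP : (ε : Matrix n n K) * P.val = P.val * Matrix.reindex e e (Matrix.fromBlocks (a • (1 : Matrix m m K)) 0 0 (u • (1 : Matrix (Fin 1) (Fin 1) K)))) :
    (ε : Matrix n n K) *ᵥ (P.val *ᵥ Pi.single (e (Sum.inr 0)) 1) = u • (P.val *ᵥ Pi.single (e (Sum.inr 0)) 1) := by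
  rw [Matrix.mulVec_mulVec, hP, ← Matrix.mulVec_mulVec, reindex_fromBlocks_mulVec_single, Sum.elim_inr, Matrix.mulVec_smul]

omit [Fintype m] [DecidableEq m] in
/-- `v₁ = P e_{inr 0} ≠ 0` (`P` invertible). [cite: Rogawski1990, §3.8 Prop. 3.8.1 p. 30] -/
theorem frameVec_ne_zero : P.val *ᵥ Pi.single (e (Sum.inr 0)) (1 : K) ≠ 0 := by
  intro h
  have h1 : (P⁻¹).val *ᵥ (P.val *ᵥ Pi.single (e (Sum.inr 0)) (1 : K)) = Pi.single (e (Sum.inr 0)) 1 := by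
    rw [Matrix.mulVec_mulVec, ← Units.val_mul, inv_mul_cancel, Units.val_one, Matrix.one_mulVec]
  rw [h, Matrix.mulVec_zero] at h1
  have h2 := congrFun h1 (e (Sum.inr 0))
  rw [Pi.zero_apply, Pi.single_eq_same] at h2
  exact one_ne_zero h2.symm

/-- **`χ_ε = χ_{a·1_m} · (X − u)`** under the frame. [cite: Rogawski1990, §3.8 Prop. 3.8.1 p. 30] -/
theorem charpoly_eq_of_frame
    (hP : (ε : Matrix n n K) * P.val = P.val * Matrix.reindex e e (Matrix.fromBlocks (a • (1 : Matrix m m K)) 0 0 (u • (1 : Matrix (Fin 1) (Fin 1) K)))) :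
    (ε : Matrix n n K).charpoly = (X - C u) * (a • (1 : Matrix m m K)).charpoly := by
  have h1 : (ε : Matrix n n K) = P.val * Matrix.reindex e e (Matrix.fromBlocks (a • (1 : Matrix m m K)) 0 0 (u • (1 : Matrix (Fin 1) (Fin 1) K))) * P.val⁻¹ := by
    rw [← hP, Matrix.mul_assoc, Matrix.mul_nonsing_inv _ ((Matrix.isUnit_iff_isUnit_det _).1 (Units.isUnit P)), Matrix.mul_one]
  rw [h1, Matrix.charpoly_units_conj, Matrix.charpoly_reindex, Matrix.charpoly_fromBlocks_zero₁₂, mul_comm]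
  congr 1
  rw [Matrix.smul_one_eq_diagonal, Matrix.charpoly_diagonal, Finset.prod_const, Finset.card_univ, Fintype.card_fin, pow_one]

/-- **THE FRAME VECTOR IS ANISOTROPIC**: `h(v₁, v₁) ≠ 0` for `ε ∈ U(σ, J)` unitary with the frame, `a ≠ u`, `u σ(u) = 1`, `det J ≠ 0` (★ (F-guard): `u` is a simple root of
`χ_ε = (X − u)(X − a)^{|m|}`). [cite: Dieudonne1971GroupesClassiques, Chap. II §4] [cite: Rogawski1990, §8.2 Prop. 8.2.1 p. 112] -/
theorem hermForm_frameVec_ne_zero (hJd : J.det ≠ 0) (hε : ε ∈ unitaryGroupOfForm σ J)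
    (hP : (ε : Matrix n n K) * P.val = P.val * Matrix.reindex e e (Matrix.fromBlocks (a • (1 : Matrix m m K)) 0 0 (u • (1 : Matrix (Fin 1) (Fin 1) K))))
    (hau : a ≠ u) (hu1 : u * σ u = 1) :
    hermForm σ J (P.val *ᵥ Pi.single (e (Sum.inr 0)) 1) (P.val *ᵥ Pi.single (e (Sum.inr 0)) 1) ≠ 0 := by
  refine hermForm_self_ne_zero_of_eigen_simple σ J hJd hε frameVec_ne_zero (mulVec_frameVec_eq_smul hP) hu1 (charpoly_eq_of_frame hP) ?_
  rw [Matrix.smul_one_eq_diagonal, Matrix.charpoly_diagonal, Polynomial.eval_prod]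
  refine Finset.prod_ne_zero_iff.2 fun i _ => ?_
  rw [eval_sub, eval_X, eval_C]
  exact sub_ne_zero.2 (Ne.symm hau)

/-! ## §2 Elements of the centraliser: block form, eigenvalue at `v₁`, split characteristic polynomial -/

/-- Sylvester disjointness of the scalar blocks `a·1`, `u·1` (`a ≠ u`). [cite: Rogawski1990, §3.8 Prop. 3.8.1 p. 30] -/
private theorem hAC_of_ne (hau : a ≠ u) : ∀ X : Matrix m (Fin 1) K, a • (1 : Matrix m m K) * X = X * (u • (1 : Matrix (Fin 1) (Fin 1) K)) → X = 0 :=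
  fun X hX => by
    rw [Matrix.smul_mul, Matrix.one_mul, Matrix.mul_smul, Matrix.mul_one, ← sub_eq_zero, ← sub_smul, smul_eq_zero] at hX
    exact hX.resolve_left (sub_ne_zero.2 hau)

/-- Sylvester disjointness of the scalar blocks `u·1`, `a·1` (`a ≠ u`), transposed form. [cite: Rogawski1990, §3.8 Prop. 3.8.1 p. 30] -/
private theorem hCA_of_ne (hau : a ≠ u) : ∀ Y : Matrix (Fin 1) m K, u • (1 : Matrix (Fin 1) (Fin 1) K) * Y = Y * (a • (1 : Matrix m m K)) → Y = 0 :=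
  fun Y hY => by
    rw [Matrix.smul_mul, Matrix.one_mul, Matrix.mul_smul, Matrix.mul_one, ← sub_eq_zero, ← sub_smul, smul_eq_zero] at hY
    exact hY.resolve_left (sub_ne_zero.2 hau.symm)

/-- **Centraliser elements in the frame.** `t ε = ε t` ⇒ `P⁻¹ t P = reindex e (B ⊕ D)` with `t v₁ = (D 0 0) • v₁` and `χ_t = (X − D 0 0) · χ_B`.
[cite: Rogawski1990, §3.8 Prop. 3.8.1 p. 30] -/
theorem exists_blocks_of_commute
    (hP : (ε : Matrix n n K) * P.val = P.val * Matrix.reindex e e (Matrix.fromBlocks (a • (1 : Matrix m m K)) 0 0 (u • (1 : Matrix (Fin 1) (Fin 1) K))))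
    (hau : a ≠ u) {t : Matrix n n K} (ht : Commute t (ε : Matrix n n K)) :
    ∃ (B : Matrix m m K) (l : K), t *ᵥ (P.val *ᵥ Pi.single (e (Sum.inr 0)) 1) = l • (P.val *ᵥ Pi.single (e (Sum.inr 0)) 1) ∧
      t.charpoly = (X - C l) * B.charpoly := by
  obtain ⟨B, D, -, -, hBD⟩ := conj_eq_fromBlocks_of_commute hP (hAC_of_ne hau) (hCA_of_ne hau) ht
  have ht' : t = P.val * Matrix.reindex e e (Matrix.fromBlocks B 0 0 D) * P.val⁻¹ := by
    rw [← hBD]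
    rw [show P.val * ((P⁻¹).val * t * P.val) * P.val⁻¹ = (P.val * (P⁻¹).val) * t * (P.val * P.val⁻¹) by simp only [Matrix.mul_assoc],
      ← Units.val_mul, mul_inv_cancel, Units.val_one, Matrix.one_mul,
      Matrix.mul_nonsing_inv _ ((Matrix.isUnit_iff_isUnit_det _).1 (Units.isUnit P)), Matrix.mul_one]
  have hD : D = (D 0 0) • (1 : Matrix (Fin 1) (Fin 1) K) := by
    ext i j
    have hi : i = 0 := Subsingleton.elim _ _
    have hj : j = 0 := Subsingleton.elim _ _
    subst hi; subst hj
    rw [Matrix.smul_apply, Matrix.one_apply_eq, smul_eq_mul, mul_one]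
  refine ⟨B, D 0 0, ?_, ?_⟩
  · -- eigenvector: `t (P e) = P (B ⊕ D) e = (D 0 0) • P e`
    have h1 : (P.val)⁻¹ *ᵥ (P.val *ᵥ Pi.single (e (Sum.inr 0)) (1 : K)) = Pi.single (e (Sum.inr 0)) 1 := by
      rw [Matrix.mulVec_mulVec, Matrix.nonsing_inv_mul _ ((Matrix.isUnit_iff_isUnit_det _).1 (Units.isUnit P)), Matrix.one_mulVec]
    have h2 : Matrix.reindex e e (Matrix.fromBlocks B 0 0 D) *ᵥ Pi.single (e (Sum.inr 0)) 1 = (D 0 0) • Pi.single (e (Sum.inr 0)) 1 := by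
      have hB0 : Matrix.fromBlocks B 0 0 D = Matrix.fromBlocks B 0 0 ((D 0 0) • (1 : Matrix (Fin 1) (Fin 1) K)) := by rw [← hD]
      ext i
      rw [Matrix.mulVec_single_one, Matrix.col_apply, Pi.smul_apply, smul_eq_mul]
      obtain ⟨j, rfl⟩ := e.surjective i
      rw [reindex_apply_apply']
      rcases j with j | j
      · rw [Matrix.fromBlocks_apply₁₂, Matrix.zero_apply, Pi.single_eq_of_ne (fun h => Sum.inl_ne_inr (e.injective h)), mul_zero]
      · have hj : j = 0 := Subsingleton.elim _ _
        subst hj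
        rw [Matrix.fromBlocks_apply₂₂, Pi.single_eq_same, mul_one]
    rw [ht', ← Matrix.mulVec_mulVec, ← Matrix.mulVec_mulVec, h1, h2, Matrix.mulVec_smul]
  · have hχD : D.charpoly = X - C (D 0 0) := by
      conv_lhs => rw [hD, Matrix.smul_one_eq_diagonal, Matrix.charpoly_diagonal]
      rw [Finset.prod_const, Finset.card_univ, Fintype.card_fin, pow_one]
    rw [ht', Matrix.charpoly_units_conj, Matrix.charpoly_reindex, Matrix.charpoly_fromBlocks_zero₁₂, hχD, mul_comm]

/-- **Elements of `Z_U(ε)` at the frame vector.** For `t ∈ U(σ, J)` commuting with `ε` (frame as above, `a ≠ u`, `u σ u = 1`, `det J ≠ 0`): `t v₁ = λ v₁` with `λ σ(λ) = 1` and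
`χ_t = (X − λ)·q` for some `q` (= `χ` of the `E₂`-block). [cite: Rogawski1990, §8.2 Prop. 8.2.1 p. 112] [cite: Dieudonne1971GroupesClassiques, Chap. II §4] -/
theorem exists_eigen_of_commute (hJd : J.det ≠ 0) (hε : ε ∈ unitaryGroupOfForm σ J)
    (hP : (ε : Matrix n n K) * P.val = P.val * Matrix.reindex e e (Matrix.fromBlocks (a • (1 : Matrix m m K)) 0 0 (u • (1 : Matrix (Fin 1) (Fin 1) K))))
    (hau : a ≠ u) (hu1 : u * σ u = 1) {t : GL n K} (htU : t ∈ unitaryGroupOfForm σ J) (ht : Commute (t : Matrix n n K) (ε : Matrix n n K)) :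
    ∃ (l : K) (q : K[X]), (t : Matrix n n K) *ᵥ (P.val *ᵥ Pi.single (e (Sum.inr 0)) 1) = l • (P.val *ᵥ Pi.single (e (Sum.inr 0)) 1) ∧ l * σ l = 1 ∧
      (t : Matrix n n K).charpoly = (X - C l) * q := by
  obtain ⟨B, l, htv, hχ⟩ := exists_blocks_of_commute hP hau ht
  refine ⟨l, B.charpoly, htv, ?_, hχ⟩
  -- `h(t v₁, t v₁) = h(v₁, v₁)` and `t v₁ = l v₁` ⇒ `σ(l) l = 1`
  have hβ := hermForm_frameVec_ne_zero σ J hJd hε hP hau hu1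
  have h1 := (mem_unitaryGroupOfForm_iff_hermForm σ J t).1 htU (P.val *ᵥ Pi.single (e (Sum.inr 0)) 1) (P.val *ᵥ Pi.single (e (Sum.inr 0)) 1)
  rw [htv, hermForm_smul_left_eq, hermForm_smul_right, ← mul_assoc] at h1
  have h2 : σ l * l = 1 := mul_right_cancel₀ hβ (h1.trans (one_mul _).symm)
  rwa [mul_comm] at h2

/-! ## §3 The stabiliser of `v₁` lies in the centraliser of `ε` -/

omit [DecidableEq n] in
/-- `(u ⊗ r) z = ⟨r, z⟩ u` over a commutative ring. [folklore] -/
private theorem vecMulVec_mulVec_eq_smul'' (x r z : n → K) : Matrix.vecMulVec x r *ᵥ z = (r ⬝ᵥ z) • x := by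
  rw [Matrix.vecMulVec_mulVec]
  funext i
  simp [mul_comm]

omit [Fintype m] in
/-- **`v₁^⊥` contains the `a`-eigenvectors**: `h(v₁, P e_{inl i}) = 0` (the `a`- and `u`-eigenspaces of the unitary `ε` are orthogonal because `σ(u)·a ≠ 1`).
[cite: Dieudonne1971GroupesClassiques, Chap. II §4] -/
theorem hermForm_frameVec_inl_eq_zero (hε : ε ∈ unitaryGroupOfForm σ J)
    (hP : (ε : Matrix n n K) * P.val = P.val * Matrix.reindex e e (Matrix.fromBlocks (a • (1 : Matrix m m K)) 0 0 (u • (1 : Matrix (Fin 1) (Fin 1) K))))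
    (hau : a ≠ u) (hu1 : u * σ u = 1) (i : m) :
    hermForm σ J (P.val *ᵥ Pi.single (e (Sum.inr 0)) 1) (P.val *ᵥ Pi.single (e (Sum.inl i)) 1) = 0 := by
  have hεi : (ε : Matrix n n K) *ᵥ (P.val *ᵥ Pi.single (e (Sum.inl i)) 1) = a • (P.val *ᵥ Pi.single (e (Sum.inl i)) 1) := by
    rw [Matrix.mulVec_mulVec, hP, ← Matrix.mulVec_mulVec, reindex_fromBlocks_mulVec_single, Sum.elim_inl, Matrix.mulVec_smul]
  have h1 := (mem_unitaryGroupOfForm_iff_hermForm σ J ε).1 hε (P.val *ᵥ Pi.single (e (Sum.inr 0)) 1) (P.val *ᵥ Pi.single (e (Sum.inl i)) 1)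
  rw [mulVec_frameVec_eq_smul hP, hεi, hermForm_smul_left_eq, hermForm_smul_right, ← mul_assoc] at h1
  -- `(σ u * a) h = h` with `σ u * a ≠ 1`
  have hne : σ u * a ≠ 1 := by
    intro h
    apply hau
    have h2 : σ u * a = σ u * u := by rw [h, mul_comm, hu1]
    have hσu : σ u ≠ 0 := fun h0 => by rw [h0, mul_zero] at hu1; exact zero_ne_one hu1
    exact mul_left_cancel₀ hσu h2
  by_contra hh
  exact hne (mul_right_cancel₀ hh (h1.trans (one_mul _).symm))

/-- **`ε = a·1 + ((u − a)∕β) · v₁ ⊗ hermRow v₁`**, `β = h(v₁, v₁)`: `ε` acts by `a` on `v₁^⊥` and by `u` on `v₁` (tested on the frame basis `P e_j`).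
[cite: Dieudonne1971GroupesClassiques, Chap. II §4] [cite: Rogawski1990, §8.2 Prop. 8.2.1 p. 112] -/
theorem eq_smul_one_add_smul_vecMulVec_of_frame (hJd : J.det ≠ 0) (hε : ε ∈ unitaryGroupOfForm σ J)
    (hP : (ε : Matrix n n K) * P.val = P.val * Matrix.reindex e e (Matrix.fromBlocks (a • (1 : Matrix m m K)) 0 0 (u • (1 : Matrix (Fin 1) (Fin 1) K))))
    (hau : a ≠ u) (hu1 : u * σ u = 1) :
    (ε : Matrix n n K) = a • (1 : Matrix n n K) +
      ((u - a) * (hermForm σ J (P.val *ᵥ Pi.single (e (Sum.inr 0)) 1) (P.val *ᵥ Pi.single (e (Sum.inr 0)) 1))⁻¹) •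
        Matrix.vecMulVec (P.val *ᵥ Pi.single (e (Sum.inr 0)) 1) (hermRow σ J (P.val *ᵥ Pi.single (e (Sum.inr 0)) 1)) := by
  set v₁ : n → K := P.val *ᵥ Pi.single (e (Sum.inr 0)) 1 with hv₁
  set β : K := hermForm σ J v₁ v₁ with hβdef
  have hβ0 : β ≠ 0 := hermForm_frameVec_ne_zero σ J hJd hε hP hau hu1
  set M : Matrix n n K := a • (1 : Matrix n n K) + ((u - a) * β⁻¹) • Matrix.vecMulVec v₁ (hermRow σ J v₁) with hM
  -- both sides agree on every `P e_j`
  have hcol : ∀ j : m ⊕ Fin 1, (ε : Matrix n n K) *ᵥ (P.val *ᵥ Pi.single (e j) 1) = M *ᵥ (P.val *ᵥ Pi.single (e j) 1) := by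
    intro j
    have hMv : ∀ y : n → K, M *ᵥ y = a • y + (((u - a) * β⁻¹) * hermForm σ J v₁ y) • v₁ := fun y => by
      rw [hM, Matrix.add_mulVec, Matrix.smul_mulVec, Matrix.one_mulVec, Matrix.smul_mulVec, vecMulVec_mulVec_eq_smul'', hermRow_dotProduct,
        smul_smul]
    rw [hMv]
    rcases j with i | i
    · rw [hermForm_frameVec_inl_eq_zero σ J hε hP hau hu1 i, mul_zero, zero_smul, add_zero, Matrix.mulVec_mulVec, hP, ← Matrix.mulVec_mulVec,
        reindex_fromBlocks_mulVec_single, Sum.elim_inl, Matrix.mulVec_smul]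
    · have hi : i = 0 := Subsingleton.elim _ _
      subst hi
      rw [← hv₁, mulVec_frameVec_eq_smul hP, ← hβdef, mul_assoc, inv_mul_cancel₀ hβ0, mul_one, ← add_smul, add_sub_cancel]
  -- hence `ε P = M P`, hence `ε = M`
  have hεP : (ε : Matrix n n K) * P.val = M * P.val := by
    ext i k
    obtain ⟨j, rfl⟩ := e.surjective k
    have h := congrFun (hcol j) i
    rw [Matrix.mulVec_mulVec, Matrix.mulVec_mulVec, Matrix.mulVec_single_one, Matrix.mulVec_single_one, Matrix.col_apply, Matrix.col_apply] at h
    exact h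
  calc (ε : Matrix n n K) = (ε : Matrix n n K) * P.val * P.val⁻¹ := by
        rw [Matrix.mul_assoc, Matrix.mul_nonsing_inv _ ((Matrix.isUnit_iff_isUnit_det _).1 (Units.isUnit P)), Matrix.mul_one]
    _ = M := by rw [hεP, Matrix.mul_assoc, Matrix.mul_nonsing_inv _ ((Matrix.isUnit_iff_isUnit_det _).1 (Units.isUnit P)), Matrix.mul_one]

/-- **`g ∈ U(σ, J)`, `g v₁ = v₁` ⇒ `g` commutes with `ε`** (`g` fixes `v₁` and, being unitary, preserves `h(v₁, ·)`, so it commutes with `v₁ ⊗ hermRow v₁`; and `ε` is a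
combination of `1` and that rank-one matrix).  Hence `Stab_U(v₁) ≤ Z_U(ε)`. [cite: Dieudonne1971GroupesClassiques, Chap. II §4] [cite: Rogawski1990, §8.2 Prop. 8.2.1 p. 112] -/
theorem commute_of_mulVec_frameVec_eq (hJd : J.det ≠ 0) (hε : ε ∈ unitaryGroupOfForm σ J)
    (hP : (ε : Matrix n n K) * P.val = P.val * Matrix.reindex e e (Matrix.fromBlocks (a • (1 : Matrix m m K)) 0 0 (u • (1 : Matrix (Fin 1) (Fin 1) K))))
    (hau : a ≠ u) (hu1 : u * σ u = 1) {g : GL n K} (hgU : g ∈ unitaryGroupOfForm σ J)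
    (hg : (g : Matrix n n K) *ᵥ (P.val *ᵥ Pi.single (e (Sum.inr 0)) 1) = P.val *ᵥ Pi.single (e (Sum.inr 0)) 1) :
    Commute (g : Matrix n n K) (ε : Matrix n n K) := by
  set v₁ : n → K := P.val *ᵥ Pi.single (e (Sum.inr 0)) 1 with hv₁
  -- `hermRow v₁ ᵥ* g = hermRow v₁` (i.e. `h(v₁, g z) = h(v₁, z)`)
  have hrow : hermRow σ J v₁ ᵥ* (g : Matrix n n K) = hermRow σ J v₁ := by
    have hz : ∀ z : n → K, hermForm σ J v₁ ((g : Matrix n n K) *ᵥ z) = hermForm σ J v₁ z := fun z => by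
      have h := (mem_unitaryGroupOfForm_iff_hermForm σ J g).1 hgU v₁ z
      rwa [hg] at h
    funext k
    have h := hz (Pi.single k 1)
    rw [← hermRow_dotProduct, ← hermRow_dotProduct, Matrix.dotProduct_mulVec, dotProduct_single_one, dotProduct_single_one] at h
    exact h
  rw [eq_smul_one_add_smul_vecMulVec_of_frame σ J hJd hε hP hau hu1, ← hv₁]
  show (g : Matrix n n K) * _ = _ * (g : Matrix n n K)
  rw [Matrix.mul_add, Matrix.add_mul, Matrix.mul_smul, Matrix.smul_mul, Matrix.mul_one, Matrix.one_mul, Matrix.mul_smul, Matrix.smul_mul,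
    Matrix.mul_vecMulVec, hg, Matrix.vecMulVec_mul, hrow]

end Frame

end Literature.NumberTheory.Automorphic.UnitaryGroup
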